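import Summits.AtomisticToContinuum.Crystallization.Theorems.FrustratedLawDichotomyStrainedPatchHomValueT2SoundU

/-!
# (I1) part V — THE TWO LABEL FAMILIES IN THE KIT'S BOX (roadmap for `valueLeafT2J_sound`, step 6a): `…SoundR.label_floor` instantiated for an
# `A`-family label (`q = p_b`, `Δξ = 0`, `top = 6`, masked) and a `B`-family label (`q = p_b + hcpShift + ξ_c`, `Δξ = ξ − ξ_c`, `top = 9`) of the box
# `(c, w)` with `V = cenMap c`, `ΔU = U − cenMap c` for a self-adjoint `U` in the box, plus the range-`6` → range-`9` conversions of the `A`-family sums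
# (27623 `(H) HomFloor`, hcp half; decomp-a2c hand-1 g49; critic row 1674 (B) (I1) docket).

No definitions; 0 sorry; standard axioms; no instances / notation / `#eval`.  `--supports stmt-AtomisticToContinuum-27623`.
-/

noncomputable section

namespace Summit.AtomisticToContinuum.Crystallization.Theorems.FrustratedLawDichotomyStrainedPatchHomValueT2Kit

open scoped BigOperators RealInnerProductSpace
open Finset
open Literature.Analysis.ValidatedNumerics.Numerics
open Summit.AtomisticToContinuum.Crystallization.Theorems.ChargedEnergyGapNegative (E3)
open Summit.AtomisticToContinuum.Crystallization.Theorems.FrustratedLawDichotomySchurCut (effPot w₄₅ ω₄)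
open Summit.AtomisticToContinuum.Crystallization.Theorems.FrustratedLawDichotomyStrainedPatchTaylorLeaves (junctions)
open Summit.AtomisticToContinuum.Crystallization.Theorems.FrustratedLawDichotomyStrainedPatchHomSplit (latPt hexFrame hcpShift)
open Summit.AtomisticToContinuum.Crystallization.Theorems.FrustratedLawDichotomyStrainedPatchHomEntryGramHcp (shufFI)
open Summit.AtomisticToContinuum.Crystallization.Theorems.FrustratedLawDichotomyStrainedPatchHomCurvCentreKit (boxE cenE cenX cenMap cenShuf)

/-! ## §1. Range conversions for the `A` family -/

/-- `Σ_{k<6} f k·(dispN ΔU 0 k) = Σ_{k<9} [k<6] f k · δ_k`. [formal bookkeeping] -/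
theorem sum6_disp0 (ΔU : E3 →L[ℝ] E3) (Δξ : E3) (f : ℕ → ℝ) :
    ∑ k ∈ range 6, f k * dispN ΔU 0 k = ∑ k ∈ range 9, (if k < 6 then f k else 0) * dispN ΔU Δξ k := by
  have e : ∀ k ∈ range 9, (if k < 6 then f k else 0) * dispN ΔU Δξ k = (if k < 6 then f k * dispN ΔU 0 k else 0) := by
    intro k hk
    have hk9 := Finset.mem_range.1 hk
    rw [dispN_xi_zero ΔU Δξ hk9]
    split_ifs <;> simp
  rw [Finset.sum_congr rfl e]
  simp [Finset.sum_range_succ]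

/-- The double version. [formal bookkeeping] -/
theorem sum66_disp0 (ΔU : E3 →L[ℝ] E3) (Δξ : E3) (F : ℕ → ℕ → ℝ) :
    ∑ k ∈ range 6, ∑ l ∈ range 6, F k l * (dispN ΔU 0 k * dispN ΔU 0 l) =
      ∑ k ∈ range 9, ∑ l ∈ range 9, (if k < 6 ∧ l < 6 then F k l else 0) * (dispN ΔU Δξ k * dispN ΔU Δξ l) := by
  calc ∑ k ∈ range 6, ∑ l ∈ range 6, F k l * (dispN ΔU 0 k * dispN ΔU 0 l)
      = ∑ k ∈ range 6, (∑ l ∈ range 6, F k l * dispN ΔU 0 l) * dispN ΔU 0 k := by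
        refine Finset.sum_congr rfl fun k _ => ?_
        rw [Finset.sum_mul]
        exact Finset.sum_congr rfl fun l _ => by ring
    _ = ∑ k ∈ range 9, (if k < 6 then ∑ l ∈ range 6, F k l * dispN ΔU 0 l else 0) * dispN ΔU Δξ k := sum6_disp0 ΔU Δξ _
    _ = ∑ k ∈ range 9, ∑ l ∈ range 9, (if k < 6 ∧ l < 6 then F k l else 0) * (dispN ΔU Δξ k * dispN ΔU Δξ l) := by
        refine Finset.sum_congr rfl fun k _ => ?_
        by_cases hk6 : k < 6
        · rw [if_pos hk6, sum6_disp0 ΔU Δξ, Finset.sum_mul]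
          refine Finset.sum_congr rfl fun l _ => ?_
          by_cases hl6 : l < 6
          · rw [if_pos hl6, if_pos ⟨hk6, hl6⟩]; ring
          · rw [if_neg hl6, if_neg (fun h => hl6 h.2)]; ring
        · rw [if_neg hk6, zero_mul]
          symm
          exact Finset.sum_eq_zero fun l _ => by rw [if_neg (fun h => hk6 h.1)]; ring

/-- `|dispN ΔU 0 k| ≤ |δ_k|`. [formal bookkeeping] -/
theorem abs_disp0_le (ΔU : E3 →L[ℝ] E3) (Δξ : E3) {k : ℕ} (hk : k < 9) : |dispN ΔU 0 k| ≤ |dispN ΔU Δξ k| := by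
  rw [dispN_xi_zero ΔU Δξ hk]; split_ifs <;> simp

/-! ## §2. The symmetric displacement of the box -/

/-- For a self-adjoint `U` and a box with symmetric centre entries, `U − U_c` has symmetric entries. [formal bookkeeping] -/
theorem ent_symm_disp {c : (Fin 3 × Fin 3) ⊕ Fin 3 → ℤ} (U : E3 →L[ℝ] E3) (hsa : ∀ v v' : E3, ⟪U v, v'⟫ = ⟪v, U v'⟫)
    (hc : ∀ a b : Fin 3, c (Sum.inl (a, b)) = c (Sum.inl (b, a))) (a b : Fin 3) : ent (U - cenMap c) a b = ent (U - cenMap c) b a := by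
  rw [ent_sub, ent_sub, ent_symm_of_selfAdjoint hsa a b, ent_cenMap_symm hc a b]

/-! ## §3. ★ The two label floors in the box -/

/-- ★★ **`A`-FAMILY LABEL FLOOR** in the box `(c, w)`: `…SoundR.label_floor` with `V = U_c`, `ΔU = U − U_c`, `q = p_b`, `Δξ = 0`, `top = 6`, masked.
[folklore chaining] -/
theorem floorA {c w : (Fin 3 × Fin 3) ⊕ Fin 3 → ℤ} (U : E3 →L[ℝ] E3) (hsa : ∀ v v' : E3, ⟪U v, v'⟫ = ⟪v, U v'⟫)
    (hc : ∀ a b : Fin 3, c (Sum.inl (a, b)) = c (Sum.inl (b, a)))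
    (hbox : ∀ ab : Fin 3 × Fin 3, |(U (EuclideanSpace.single ab.2 (1 : ℝ))) ab.1 - (c (Sum.inl ab) : ℝ) / SC| ≤ (w (Sum.inl ab) : ℝ) / SC)
    {b : Fin 3 → ℤ} {Rb Rp : DRec} (hRb : mkDRec 6 (boxE c w) (pA b) = some Rb) (hRp : mkDRec 6 (cenE c) (pA b) = some Rp)
    (hJ : ‖latPt (cenMap c) hexFrame b‖ ∉ junctions) :
    effPot w₄₅ ω₄ (3 / 400) ‖cenMap c (latPt (1 : E3 →L[ℝ] E3) hexFrame b)‖ +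
      deriv (effPot w₄₅ ω₄ (3 / 400)) ‖cenMap c (latPt (1 : E3 →L[ℝ] E3) hexFrame b)‖ / ‖cenMap c (latPt (1 : E3 →L[ℝ] E3) hexFrame b)‖ *
        ∑ k ∈ range 6, zetaN (cenMap c) (latPt (1 : E3 →L[ℝ] E3) hexFrame b) k * dispN (U - cenMap c) 0 k +
      1 / 2 * ∑ k ∈ range 6, ∑ l ∈ range 6,
        ((deriv (deriv (effPot w₄₅ ω₄ (3 / 400))) ‖cenMap c (latPt (1 : E3 →L[ℝ] E3) hexFrame b)‖ -
              deriv (effPot w₄₅ ω₄ (3 / 400)) ‖cenMap c (latPt (1 : E3 →L[ℝ] E3) hexFrame b)‖ / ‖cenMap c (latPt (1 : E3 →L[ℝ] E3) hexFrame b)‖) /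
              ‖cenMap c (latPt (1 : E3 →L[ℝ] E3) hexFrame b)‖ ^ 2 *
            (zetaN (cenMap c) (latPt (1 : E3 →L[ℝ] E3) hexFrame b) k * zetaN (cenMap c) (latPt (1 : E3 →L[ℝ] E3) hexFrame b) l) +
          deriv (effPot w₄₅ ω₄ (3 / 400)) ‖cenMap c (latPt (1 : E3 →L[ℝ] E3) hexFrame b)‖ / ‖cenMap c (latPt (1 : E3 →L[ℝ] E3) hexFrame b)‖ *
            nuR (cenMap c) (latPt (1 : E3 →L[ℝ] E3) hexFrame b) k l) * (dispN (U - cenMap c) 0 k * dispN (U - cenMap c) 0 l) -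
      1 / 2 * (if Rb.co.lip then 0 else ∑ k ∈ range 6, ∑ l ∈ range 6,
        ((max |((hessOf Rb true).getD (9 * k + l) fi0).hi - ((hessOf Rp true).getD (9 * k + l) fi0).lo|
              |((hessOf Rp true).getD (9 * k + l) fi0).hi - ((hessOf Rb true).getD (9 * k + l) fi0).lo| : ℤ) : ℝ) / SC *
          (|dispN (U - cenMap c) 0 k| * |dispN (U - cenMap c) 0 l|)) -
      1 / 6 * (if Rb.co.lip then ∑ a ∈ range 6, ∑ b' ∈ range 6, ∑ m ∈ range 6,
        (if a ≤ b' ∧ b' ≤ m then (if a = b' then (if b' = m then (1 : ℝ) else 3) else (if b' = m then 3 else 6)) *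
          ((((thirdOf Rb a b' m).absHi : ℤ) : ℝ) / SC * (|dispN (U - cenMap c) 0 a| * |dispN (U - cenMap c) 0 b'| * |dispN (U - cenMap c) 0 m|))
          else 0) else 0) ≤
      effPot w₄₅ ω₄ (3 / 400) ‖latPt U hexFrame b‖ := by
  have hsym := ent_symm_disp U hsa hc
  have hδ0 : ∀ k, 6 ≤ k → k < 9 → dispN (U - cenMap c) 0 k = 0 := fun k hk hk9 => by
    rw [dispN_xi_zero (U - cenMap c) 0 hk9, if_neg (by omega)]
  have hJ' : ‖cenMap c (latPt (1 : E3 →L[ℝ] E3) hexFrame b)‖ ∉ junctions := by rw [← latPt_eq_apply_one]; exact hJ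
  have h := label_floor (cenMap c) (U - cenMap c) (latPt (1 : E3 →L[ℝ] E3) hexFrame b) 0 hsym (top := 6) (by norm_num) true
    (fun _ => le_rfl) hδ0 hRb hRp (fun t ht ab => mem_boxE_segment U hbox ht ab) (fun t _ cc => mem_pA_segment b t cc) (mem_cenE c) (mem_pA b) hJ'
  have eU : (cenMap c + (U - cenMap c)) (latPt (1 : E3 →L[ℝ] E3) hexFrame b + 0) = latPt U hexFrame b := by
    rw [add_zero, add_sub_cancel, ← latPt_eq_apply_one]
  rw [eU] at h
  exact h

/-- ★★ **`B`-FAMILY LABEL FLOOR** in the box `(c, w)`: `…SoundR.label_floor` with `V = U_c`, `ΔU = U − U_c`, `q = p_b + hcpShift + ξ_c`, `Δξ = ξ − ξ_c`,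
`top = 9`. [folklore chaining] -/
theorem floorB {c w : (Fin 3 × Fin 3) ⊕ Fin 3 → ℤ} (U : E3 →L[ℝ] E3) (ξ : E3) (hsa : ∀ v v' : E3, ⟪U v, v'⟫ = ⟪v, U v'⟫)
    (hc : ∀ a b : Fin 3, c (Sum.inl (a, b)) = c (Sum.inl (b, a)))
    (hbox : ∀ ab : Fin 3 × Fin 3, |(U (EuclideanSpace.single ab.2 (1 : ℝ))) ab.1 - (c (Sum.inl ab) : ℝ) / SC| ≤ (w (Sum.inl ab) : ℝ) / SC)
    (hξ : ∀ i : Fin 3, |ξ i - (c (Sum.inr i) : ℝ) / SC| ≤ (w (Sum.inr i) : ℝ) / SC)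
    {b : Fin 3 → ℤ} {Rb Rp : DRec} (hRb : mkDRec 9 (boxE c w) (qB (shufFI c w) b) = some Rb) (hRp : mkDRec 9 (cenE c) (qB (cenX c) b) = some Rp)
    (hJ : ‖latPt (cenMap c) hexFrame b + cenMap c (hcpShift + cenShuf c)‖ ∉ junctions) :
    effPot w₄₅ ω₄ (3 / 400) ‖cenMap c (latPt (1 : E3 →L[ℝ] E3) hexFrame b + (hcpShift + cenShuf c))‖ +
      deriv (effPot w₄₅ ω₄ (3 / 400)) ‖cenMap c (latPt (1 : E3 →L[ℝ] E3) hexFrame b + (hcpShift + cenShuf c))‖ /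
          ‖cenMap c (latPt (1 : E3 →L[ℝ] E3) hexFrame b + (hcpShift + cenShuf c))‖ *
        ∑ k ∈ range 9, zetaN (cenMap c) (latPt (1 : E3 →L[ℝ] E3) hexFrame b + (hcpShift + cenShuf c)) k * dispN (U - cenMap c) (ξ - cenShuf c) k +
      1 / 2 * ∑ k ∈ range 9, ∑ l ∈ range 9,
        ((deriv (deriv (effPot w₄₅ ω₄ (3 / 400))) ‖cenMap c (latPt (1 : E3 →L[ℝ] E3) hexFrame b + (hcpShift + cenShuf c))‖ -
              deriv (effPot w₄₅ ω₄ (3 / 400)) ‖cenMap c (latPt (1 : E3 →L[ℝ] E3) hexFrame b + (hcpShift + cenShuf c))‖ /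
                ‖cenMap c (latPt (1 : E3 →L[ℝ] E3) hexFrame b + (hcpShift + cenShuf c))‖) /
              ‖cenMap c (latPt (1 : E3 →L[ℝ] E3) hexFrame b + (hcpShift + cenShuf c))‖ ^ 2 *
            (zetaN (cenMap c) (latPt (1 : E3 →L[ℝ] E3) hexFrame b + (hcpShift + cenShuf c)) k *
              zetaN (cenMap c) (latPt (1 : E3 →L[ℝ] E3) hexFrame b + (hcpShift + cenShuf c)) l) +
          deriv (effPot w₄₅ ω₄ (3 / 400)) ‖cenMap c (latPt (1 : E3 →L[ℝ] E3) hexFrame b + (hcpShift + cenShuf c))‖ /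
              ‖cenMap c (latPt (1 : E3 →L[ℝ] E3) hexFrame b + (hcpShift + cenShuf c))‖ *
            nuR (cenMap c) (latPt (1 : E3 →L[ℝ] E3) hexFrame b + (hcpShift + cenShuf c)) k l) *
        (dispN (U - cenMap c) (ξ - cenShuf c) k * dispN (U - cenMap c) (ξ - cenShuf c) l) -
      1 / 2 * (if Rb.co.lip then 0 else ∑ k ∈ range 9, ∑ l ∈ range 9,
        ((max |((hessOf Rb false).getD (9 * k + l) fi0).hi - ((hessOf Rp false).getD (9 * k + l) fi0).lo|
              |((hessOf Rp false).getD (9 * k + l) fi0).hi - ((hessOf Rb false).getD (9 * k + l) fi0).lo| : ℤ) : ℝ) / SC *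
          (|dispN (U - cenMap c) (ξ - cenShuf c) k| * |dispN (U - cenMap c) (ξ - cenShuf c) l|)) -
      1 / 6 * (if Rb.co.lip then ∑ a ∈ range 9, ∑ b' ∈ range 9, ∑ m ∈ range 9,
        (if a ≤ b' ∧ b' ≤ m then (if a = b' then (if b' = m then (1 : ℝ) else 3) else (if b' = m then 3 else 6)) *
          ((((thirdOf Rb a b' m).absHi : ℤ) : ℝ) / SC *
            (|dispN (U - cenMap c) (ξ - cenShuf c) a| * |dispN (U - cenMap c) (ξ - cenShuf c) b'| * |dispN (U - cenMap c) (ξ - cenShuf c) m|))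
          else 0) else 0) ≤
      effPot w₄₅ ω₄ (3 / 400) ‖latPt U hexFrame b + U (hcpShift + ξ)‖ := by
  have hsym := ent_symm_disp U hsa hc
  have hJ' : ‖cenMap c (latPt (1 : E3 →L[ℝ] E3) hexFrame b + (hcpShift + cenShuf c))‖ ∉ junctions := by
    rw [map_add, ← latPt_eq_apply_one]; exact hJ
  have h := label_floor (cenMap c) (U - cenMap c) (latPt (1 : E3 →L[ℝ] E3) hexFrame b + (hcpShift + cenShuf c)) (ξ - cenShuf c) hsym
    (top := 9) le_rfl false (fun h => absurd h (by simp)) (fun k hk hk9 => absurd hk9 (not_lt.2 hk)) hRb hRp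
    (fun t ht ab => mem_boxE_segment U hbox ht ab) (fun t ht cc => mem_qB_segment ξ hξ ht b cc) (mem_cenE c) (mem_qB_cen c b) hJ'
  have eU : (cenMap c + (U - cenMap c)) (latPt (1 : E3 →L[ℝ] E3) hexFrame b + (hcpShift + cenShuf c) + (ξ - cenShuf c)) =
      latPt U hexFrame b + U (hcpShift + ξ) := by
    have ea : latPt (1 : E3 →L[ℝ] E3) hexFrame b + (hcpShift + cenShuf c) + (ξ - cenShuf c) = latPt (1 : E3 →L[ℝ] E3) hexFrame b + (hcpShift + ξ) := by
      abel
    rw [add_sub_cancel, ea, map_add, ← latPt_eq_apply_one]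
  rw [eU] at h
  exact h

end Summit.AtomisticToContinuum.Crystallization.Theorems.FrustratedLawDichotomyStrainedPatchHomValueT2Kit
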